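import Literature.MathematicalPhysics.QuantumFieldTheory.Balaban1983to89.B9Eq342CombesThomasBlockForm
import Literature.MathematicalPhysics.QuantumFieldTheory.Balaban1983to89.B9Eq325QGGQCoerciveCompactZd

/-!
# `Balaban1983to89.B9Eq325QGGQDecayOfCoerciveZd` — [Balaban1985BackgroundPropagators] (3.25) p. 394 ∕ Thm 3.2 p. 398 ∕ Thm 3.11 p. 416: THE KERNEL OF
# `(Q′G′²Q′*)⁻¹` (dag-n06-w4 g2's OBJECT `cZd` on the level data `L²(𝔅, ·)`) DECAYS EXPONENTIALLY between constraint points, REDUCED TO {a COERCIVITY constant of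
# `Q′G′²Q′*` (dag-n06-w4 g4's `B9Eq325QGGQCoerciveCompactZd`), an ALMOST-LOCAL BLOCK MAJORANT of `Q′G′²Q′*`} — STATION 2 of the Combes–Thomas road at the `ℤᵈ`
# frame, by the carrier-generic engine `B9Eq342CombesThomasBlockForm` at the dictionary `π_{(j,y)} φ = φ(j,y)`, `σ_{(j,y)} w = δ_{(j,y)} w`

statement-level skeleton of published theorems with citation tags; proofs where landed; nothing here is a claim about the
Yang–Mills mass gap

`[Balaban1985BackgroundPropagators]` ("B9", CMP **99** (1985) 389–434): (3.25) p. 394 (`R = I − G′Q′*(Q′G′²Q′*)⁻¹Q′G′`, «We do not know yet if … Q′G′²Q′* [is]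
invertible. It will be proved later (Theorem 3.11)»), Thm 3.2 p. 398 (the model inverse `C = (QGQ*)⁻¹` and the decay of its kernel), Thm 3.11 p. 416
(«(Q′G′²Q′*)⁻¹ … positive definite»), Thm 3.10 (3.107)–(3.108) pp. 415–416.  Print obtains the decay of such inverses by random-walk expansions; HERE, at a
finite member, by the Combes–Thomas conjugation from two displayed inputs — the route's substitute; print's constants are NOT claimed.

CITATION HEADER (lean-in-tree rule).  Cell `pub-ymgap` (YM Track A, HUMAN RULING D-0062 ∕ D-0149 width push), DAG node N06 = [B9], width seat
`pub-ymgap-dag-n06-w2` (g4), CLAIM-6 («station 2», COORD-3 with dag-n06-w4 g4: decay instance mine, constants theirs).  Inputs BY NAME: the engine (this seat,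
FILE C `B9Eq342CombesThomasBlockForm`), dag-n06-w4 g2's `B9Eq325QGGQInvZd.{levSupp, levForm, levForm_apply, qggq, cZd, qggq_cZd, QprimeStarInjective}`,
dag-n06-w4 g4's `B9Eq325QGGQCoerciveCompactZd.exists_coercive_levForm_qggq_plaqClosed` (§4), `B9Eq324DeltaPrimeAZd.{fibreForm, single}`, `LatticeNorms.linfDist`.

WHAT IS DECLARED ∕ PROVED (kernel, 0 sorry; two small definitions with bodies + theorems; no `instance`, no `notation`).
* §1 the dictionary `L²(𝔅, ·) ↔` the engine: `levIndex m Λ` (the finite set `𝔅 = {(j,y) : j ≤ m, y ∈ Λ_j}`), `mem_levIndex_iff`, `coordL m Λ p` (`φ ↦ φ(p)`),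
  `single_mem_levSupp`, `singleL m Λ p` (`w ↦ δ_p w` for `p ∈ 𝔅`, `0` otherwise), `coordL_singleL_self ∕ _of_ne`, `sum_singleL_coordL`,
  ★ `cform_coordL_eq_levForm` (the engine's carrier form IS `levForm`).
* §2 ★★★ `fnorm_cZd_single_le_exp_of_coercive` — every unitary `U₀`, `a ≥ 0`, finite `Ω₀ = s`, `Q′*` injective, faithful Hermitian tracial `τ`, ANY location map
  `loc : ℕ × ℤᵈ → ℤᵈ` of the constraint points: a coercivity constant `c·⟨φ,φ⟩_τ ≤ ⟨φ, Q′G′²Q′*φ⟩_τ` + a block majorant `|(Q′G′²Q′* δ_{p′}w)(p)|_τ ≤ A(p,p′)|w|_τ` on `𝔅` with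
  `(e^{κ|loc p − loc p′|_∞} − 1)`-weighted row∕column sums `≤ ϱ < c` ⟹ `|((Q′G′²Q′*)⁻¹ δ_{p′}w)(p)|_τ ≤ e^{−κ|loc p − loc p′|_∞}·|w|_τ ∕ (c − ϱ)` for `p, p′ ∈ 𝔅`.
* §3 ★★★ `exists_fnorm_cZd_single_le_exp_plaqClosed` — on the CLOSED small-field class (`β < (α_Q∕L²)L^{−2m}`) dag-n06-w4 g4's coercivity constant is a THEOREM, so
  only the block majorant stays displayed.

HONEST SCOPE.  A REDUCTION (station 2): the displayed almost-local majorant of `Q′G′²Q′*` is the next file's business (from this seat's `G′` decay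
`B9Thm31GpDecayPlaqClosedZd` twice through `B9Eq349KernelCompositionZd`); `c` is dag-n06-w4 g4's compactness constant (member-dependent, non-quantitative); rate
and constant are the window's, NOT print's.  Count-neutral; N05 ∕ N06 NOT discharged; K1⁸ `stmt-QuantumFields-26907` NOT closed; one finite `𝕋⁴` programme at
fixed `ε`, Bałaban as printed; R4 closes only the conditional finite-`𝕋⁴` rung `BalabanLadder.UV` — nothing continuum ∕ ℝ⁴ ∕ OS ∕ mass gap ∕ Clay.  Unit
`pub-ymgap-dag-n06-w2` (g4), 2026-08-28.
-/

noncomputable section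

open scoped BigOperators

namespace Literature.MathematicalPhysics.QuantumFieldTheory.Balaban1983to89.B9Eq325QGGQDecayOfCoerciveZd

open B7Prop2Explicit (unitaryUnits)
open B8Ineq132 (plaqF)
open B9Eq321LandauProjectionZd (suppSub)
open B9Eq324DeltaPrimeAZd (fibreForm fibreForm_apply fibreForm_comm single)
open B9Eq325QGGQInvZd (levSupp levForm levForm_apply qggq cZd qggq_cZd QprimeStarInjective)
open B9Eq316AveragingTransposeZd (alphaQ)
open B9Eq342CombesThomasFormZd (fnorm fnorm_nonneg)
open B9Eq342CombesThomasBlockForm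
open LatticeNorms (linfDist)

export B7Prop1Explicit (Site)

variable {d : ℕ} {𝔸 : Type*} [CStarAlgebra 𝔸]

/-! ## §1  The dictionary: the level data read through their constraint-point coordinates -/

section Dictionary

variable (m : ℕ) (Λ : ℕ → Finset (Site d))

/-- **THE FINITE SET OF CONSTRAINT POINTS `𝔅 = {(j, y) : j ≤ m, y ∈ Λ_j}`.** [cite: Balaban1985BackgroundPropagators, (3.18)–(3.19) p.393 («𝔅»), (3.24) p.394] -/
def levIndex : Finset (ℕ × Site d) :=
  (Finset.range (m + 1)).biUnion fun j => (Λ j).image fun y => (j, y)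

/-- membership in `𝔅`. [cite: Balaban1985BackgroundPropagators, (3.18) p.393 (bookkeeping)] -/
theorem mem_levIndex_iff (p : ℕ × Site d) : p ∈ levIndex m Λ ↔ p.1 ∈ Finset.range (m + 1) ∧ p.2 ∈ Λ p.1 := by
  constructor
  · intro h
    rw [levIndex, Finset.mem_biUnion] at h
    obtain ⟨j, hj, hp⟩ := h
    rw [Finset.mem_image] at hp
    obtain ⟨y, hy, rfl⟩ := hp
    exact ⟨hj, hy⟩
  · rintro ⟨hj, hy⟩
    rw [levIndex, Finset.mem_biUnion]
    exact ⟨p.1, hj, Finset.mem_image.mpr ⟨p.2, hy, rfl⟩⟩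

/-- **THE COORDINATE** `φ ↦ φ(p)` of `L²(𝔅, ·)`. [cite: Balaban1985BackgroundPropagators, (3.24) p.394 (bookkeeping)] -/
def coordL (p : ℕ × Site d) : levSupp (𝔸 := 𝔸) m Λ →ₗ[ℝ] 𝔸 where
  toFun φ := (φ : ℕ × Site d → 𝔸) p
  map_add' _ _ := rfl
  map_smul' _ _ := rfl

/-- `coordL`, unfolded. [cite: Balaban1985BackgroundPropagators, (3.24) p.394 (bookkeeping)] -/
@[simp] theorem coordL_apply (p : ℕ × Site d) (φ : levSupp (𝔸 := 𝔸) m Λ) : coordL m Λ p φ = (φ : ℕ × Site d → 𝔸) p := rfl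

/-- the single-point level datum `δ_p w` lies in `L²(𝔅, ·)` for `p ∈ 𝔅`. [cite: Balaban1985BackgroundPropagators, (3.24) p.394 (bookkeeping)] -/
theorem single_mem_levSupp {p : ℕ × Site d} (hp : p ∈ levIndex m Λ) (w : 𝔸) : single p w ∈ levSupp (𝔸 := 𝔸) m Λ := by
  intro q hq
  have hqp : q ≠ p := fun h => hq (by rw [h]; exact (mem_levIndex_iff m Λ p).1 hp)
  simp [single, hqp]

open Classical in
/-- **THE SINGLE-POINT INJECTION** `w ↦ δ_p w` into `L²(𝔅, ·)` (`p ∈ 𝔅`; `0` otherwise). [cite: Balaban1985BackgroundPropagators, (3.24) p.394 (bookkeeping)] -/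
def singleL (p : ℕ × Site d) : 𝔸 →ₗ[ℝ] levSupp (𝔸 := 𝔸) m Λ :=
  if hp : p ∈ levIndex m Λ then
    { toFun := fun w => ⟨single p w, single_mem_levSupp m Λ hp w⟩
      map_add' := fun w w' => Subtype.ext (B9Eq324DeltaPrimeAZd.single_add p w w')
      map_smul' := fun c w => Subtype.ext (B9Eq324DeltaPrimeAZd.single_smul p c w) }
  else 0

/-- `singleL` at a constraint point, unfolded. [cite: Balaban1985BackgroundPropagators, (3.24) p.394 (bookkeeping)] -/
theorem singleL_coe {p : ℕ × Site d} (hp : p ∈ levIndex m Λ) (w : 𝔸) :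
    ((singleL m Λ p w : levSupp (𝔸 := 𝔸) m Λ) : ℕ × Site d → 𝔸) = single p w := by
  rw [singleL, dif_pos hp]; rfl

/-- `π_p(δ_p w) = w`. [cite: Balaban1985BackgroundPropagators, (3.24) p.394 (bookkeeping)] -/
theorem coordL_singleL_self {p : ℕ × Site d} (hp : p ∈ levIndex m Λ) (w : 𝔸) : coordL m Λ p (singleL m Λ p w) = w := by
  rw [coordL_apply, singleL_coe m Λ hp]; simp [single]

/-- `π_q(δ_p w) = 0` for `q ≠ p`. [cite: Balaban1985BackgroundPropagators, (3.24) p.394 (bookkeeping)] -/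
theorem coordL_singleL_of_ne {p q : ℕ × Site d} (hp : p ∈ levIndex m Λ) (hne : q ≠ p) (w : 𝔸) : coordL m Λ q (singleL m Λ p w) = 0 := by
  rw [coordL_apply, singleL_coe m Λ hp]; simp [single, hne]

/-- **RECONSTRUCTION**: `Σ_{p∈𝔅} δ_p(φ(p)) = φ`. [cite: Balaban1985BackgroundPropagators, (3.24) p.394 (bookkeeping)] -/
theorem sum_singleL_coordL (φ : levSupp (𝔸 := 𝔸) m Λ) : ∑ p ∈ levIndex m Λ, singleL m Λ p (coordL m Λ p φ) = φ := by
  classical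
  apply Subtype.ext
  rw [AddSubmonoidClass.coe_finsetSum]
  funext q
  rw [Finset.sum_apply]
  by_cases hq : q ∈ levIndex m Λ
  · rw [Finset.sum_eq_single_of_mem q hq]
    · rw [singleL_coe m Λ hq, coordL_apply]; simp [single]
    · intro p hp hne
      rw [singleL_coe m Λ hp, coordL_apply]; simp [single, Ne.symm hne]
  · rw [φ.2 q (fun h => hq ((mem_levIndex_iff m Λ q).2 h))]
    refine Finset.sum_eq_zero fun p hp => ?_
    rw [singleL_coe m Λ hp, coordL_apply]
    have : q ≠ p := fun h => hq (h ▸ hp)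
    simp [single, this]

variable (τ : 𝔸 →ₗ[ℂ] ℂ)

/-- ★ **THE ENGINE's CARRIER FORM IS `levForm`**: `Σ_{p∈𝔅} Re τ(φ(p)*ψ(p)) = levForm τ m Λ φ ψ`. [cite: Balaban1985BackgroundPropagators, (3.24) p.394] -/
theorem cform_coordL_eq_levForm (φ ψ : levSupp (𝔸 := 𝔸) m Λ) :
    cform (fibreForm τ) (coordL (𝔸 := 𝔸) m Λ) (levIndex m Λ) φ ψ = levForm τ m Λ φ ψ := by
  classical
  rw [levForm_apply, cform, levIndex, Finset.sum_biUnion]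
  · refine Finset.sum_congr rfl fun j _ => ?_
    rw [Finset.sum_image (fun y _ y' _ h => (Prod.mk.inj h).2)]
    rfl
  · intro j _ j' _ hjj'
    simp only [Function.onFun]
    rw [Finset.disjoint_left]
    intro p hp hp'
    rw [Finset.mem_image] at hp hp'
    obtain ⟨y, -, rfl⟩ := hp
    obtain ⟨y', -, h⟩ := hp'
    exact hjj' (Prod.mk.inj h).1.symm

end Dictionary

/-! ## §2  ★★★ The decay of `(Q′G′²Q′*)⁻¹` from a coercivity constant and a block majorant -/

section Decay

variable (L : ℕ) (U₀ : Site d → Fin d → 𝔸ˣ) (η : ℝ) (τ : 𝔸 →ₗ[ℂ] ℂ) [FiniteDimensional ℝ 𝔸]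
  (hτp : ∀ a : 𝔸, a ≠ 0 → 0 < (τ (star a * a)).re) (m : ℕ) (a : ℕ → ℝ) (Λ : ℕ → Finset (Site d)) (s : Finset (Site d))
  (hd : 0 < d) (hη : η ≠ 0) (hτt : ∀ a b : 𝔸, τ (a * b) = τ (b * a)) (hτs : ∀ a : 𝔸, τ (star a) = starRingEnd ℂ (τ a))
  (hU : ∀ (x : Site d) (κ : Fin d), U₀ x κ ∈ unitaryUnits 𝔸) (ha : ∀ j, 0 ≤ a j) (hinj : QprimeStarInjective L U₀ τ hτp m Λ s)

/-- ★★★ **[B9] (3.25) ∕ THM 3.2's DECAY FOR `(Q′G′²Q′*)⁻¹` AT THE `ℤᵈ` CARRIER, FROM A COERCIVITY CONSTANT AND AN ALMOST-LOCAL MAJORANT** (station 2).  Every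
unitary `U₀`, `a ≥ 0`, finite `Ω₀ = s`, `Q′*` injective, `0 < d`, `η ≠ 0`, faithful Hermitian tracial `τ`; a location map `loc` of the constraint points.
Suppose `c·⟨φ,φ⟩_τ ≤ ⟨φ, Q′G′²Q′*φ⟩_τ` on `L²(𝔅, ·)` and `|(Q′G′²Q′* δ_{p′}w)(p)|_τ ≤ A(p,p′)|w|_τ` on `𝔅` with `(e^{κ|loc p − loc p′|_∞} − 1)`-weighted row and column
sums over `𝔅` `≤ ϱ < c` (`κ ≥ 0`).  Then for `p, p′ ∈ 𝔅`: `|((Q′G′²Q′*)⁻¹ δ_{p′}w)(p)|_τ ≤ e^{−κ|loc p − loc p′|_∞}·|w|_τ ∕ (c − ϱ)`.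
[cite: Balaban1985BackgroundPropagators, (3.25) p.394, Thm 3.2 p.398, Thm 3.11 p.416, (3.107)–(3.108) pp.415–416; Balaban1988RG2Cluster, (2.5)–(2.7) pp.12–13] -/
theorem fnorm_cZd_single_le_exp_of_coercive (loc : ℕ × Site d → Site d) {c κ ϱ : ℝ} (hκ : 0 ≤ κ)
    (hco : ∀ φ : levSupp (𝔸 := 𝔸) m Λ, c * levForm τ m Λ φ φ ≤ levForm τ m Λ φ (qggq L U₀ η τ hτp m a Λ s hd hη hτt hτs hU ha φ))
    (Amaj : ℕ × Site d → ℕ × Site d → ℝ) (hA : ∀ p p', 0 ≤ Amaj p p')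
    (hblock : ∀ p ∈ levIndex m Λ, ∀ p' ∈ levIndex m Λ, ∀ w : 𝔸,
      fnorm τ ((qggq L U₀ η τ hτp m a Λ s hd hη hτt hτs hU ha (singleL m Λ p' w) : ℕ × Site d → 𝔸) p) ≤ Amaj p p' * fnorm τ w)
    (hrow : ∀ p ∈ levIndex m Λ, ∑ p' ∈ levIndex m Λ, Amaj p p' * (Real.exp (κ * (linfDist (loc p) (loc p') : ℝ)) - 1) ≤ ϱ)
    (hcol : ∀ p' ∈ levIndex m Λ, ∑ p ∈ levIndex m Λ, Amaj p p' * (Real.exp (κ * (linfDist (loc p) (loc p') : ℝ)) - 1) ≤ ϱ)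
    (hϱ : ϱ < c) {p p' : ℕ × Site d} (hp : p ∈ levIndex m Λ) (hp' : p' ∈ levIndex m Λ) (w : 𝔸) :
    fnorm τ ((cZd L U₀ η τ hτp m a Λ s hd hη hτt hτs hU ha hinj (singleL m Λ p' w) : ℕ × Site d → 𝔸) p) ≤
      Real.exp (-(κ * (linfDist (loc p) (loc p') : ℝ))) / (c - ϱ) * fnorm τ w := by
  have key := bsize_coord_le_exp_of_coercive_of_rowcol (β := fibreForm τ) (π := coordL (𝔸 := 𝔸) m Λ) (σ := singleL m Λ) (s := levIndex m Λ)
    (T := qggq L U₀ η τ hτp m a Λ s hd hη hτt hτs hU ha) (fibreForm_comm τ hτs)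
    (fun v => by rw [fibreForm_apply]; by_cases h : v = 0
                 · rw [h, mul_zero, map_zero, Complex.zero_re]
                 · exact (hτp v h).le)
    (sum_singleL_coordL m Λ) (fun i hi w' => coordL_singleL_self m Λ hi w') (fun i _ j hj hij w' => coordL_singleL_of_ne m Λ hj hij w')
    (dist := fun q q' => (linfDist (loc q) (loc q') : ℝ)) (fun q => by simp) (fun q q' => by rw [LatticeNorms.linfDist_comm])
    (fun q q' q'' => by exact_mod_cast LatticeNorms.linfDist_triangle (loc q) (loc q') (loc q'')) (c := c) hκ Amaj hA
    (fun i hi j hj w' => by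
      show fnorm τ _ ≤ Amaj i j * fnorm τ w'
      exact hblock i hi j hj w')
    hrow hcol (fun φ => by rw [cform_coordL_eq_levForm, cform_coordL_eq_levForm]; exact hco φ) hϱ
    (g := cZd L U₀ η τ hτp m a Λ s hd hη hτt hτs hU ha hinj (singleL m Λ p' w)) hp' (w := w) (qggq_cZd L U₀ η τ hτp m a Λ s hd hη hτt hτs hU ha hinj _) hp
  exact key

end Decay

/-! ## §3  On the closed small-field class the coercivity constant is dag-n06-w4 g4's theorem -/

section PlaqClosed

variable (L : ℕ) (η : ℝ) (τ : 𝔸 →ₗ[ℂ] ℂ) [FiniteDimensional ℝ 𝔸] [Nontrivial 𝔸]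
  (hτp : ∀ a : 𝔸, a ≠ 0 → 0 < (τ (star a * a)).re) (hτt : ∀ a b : 𝔸, τ (a * b) = τ (b * a)) (hτs : ∀ a : 𝔸, τ (star a) = starRingEnd ℂ (τ a))
  (m : ℕ) (a : ℕ → ℝ) (Λ : ℕ → Finset (Site d)) (s : Finset (Site d))

include hτt hτs in
/-- ★★★ **STATION 2 ON THE CLOSED SMALL-FIELD CLASS**: `0 < d`, `2 ≤ L`, `η ≠ 0`, `a ≥ 0`, `β < (α_Q∕L²)L^{−2m}`, `Q′*` injective at every unitary background of the
class (print's «Q′ onto»).  Then there is ONE `c > 0` (dag-n06-w4 g4) such that for EVERY unitary `U₀` of the class and every block majorant `A` of `Q′G′²Q′*` with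
rows∕columns `≤ ϱ < c` at rate `κ ≥ 0`: `|((Q′G′²Q′*)⁻¹ δ_{p′}w)(p)|_τ ≤ e^{−κ|loc p − loc p′|_∞}·|w|_τ ∕ (c − ϱ)` (`p, p′ ∈ 𝔅`).
[cite: Balaban1985BackgroundPropagators, (3.25) p.394, Thm 3.2 p.398, Thm 3.11 p.416; Balaban1985RegularSpaces, (1.7) p.77] -/
theorem exists_fnorm_cZd_single_le_exp_plaqClosed (hd : 0 < d) (hL : 2 ≤ L) (hη : η ≠ 0) (ha : ∀ j, 0 ≤ a j) {β : ℝ}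
    (hβ : β < alphaQ d L / (L : ℝ) ^ 2 * (((L : ℝ) ^ m)⁻¹) ^ 2)
    (hinj : ∀ U₀ : Site d → Fin d → 𝔸ˣ, (∀ x κ, U₀ x κ ∈ unitaryUnits 𝔸) → QprimeStarInjective L U₀ τ hτp m Λ s) (loc : ℕ × Site d → Site d) :
    ∃ c : ℝ, 0 < c ∧ ∀ (U₀ : Site d → Fin d → 𝔸ˣ) (hU : ∀ x κ', U₀ x κ' ∈ unitaryUnits 𝔸),
      (∀ (x : Site d) (μ ν : Fin d), ‖plaqF U₀ μ ν x - 1‖ ≤ β) →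
      ∀ (κ ϱ : ℝ), 0 ≤ κ → ϱ < c →
      ∀ Amaj : ℕ × Site d → ℕ × Site d → ℝ, (∀ p p', 0 ≤ Amaj p p') →
        (∀ p ∈ levIndex m Λ, ∀ p' ∈ levIndex m Λ, ∀ w : 𝔸,
          fnorm τ ((qggq L U₀ η τ hτp m a Λ s hd hη hτt hτs hU ha (singleL m Λ p' w) : ℕ × Site d → 𝔸) p) ≤ Amaj p p' * fnorm τ w) →
        (∀ p ∈ levIndex m Λ, ∑ p' ∈ levIndex m Λ, Amaj p p' * (Real.exp (κ * (linfDist (loc p) (loc p') : ℝ)) - 1) ≤ ϱ) →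
        (∀ p' ∈ levIndex m Λ, ∑ p ∈ levIndex m Λ, Amaj p p' * (Real.exp (κ * (linfDist (loc p) (loc p') : ℝ)) - 1) ≤ ϱ) →
        ∀ p ∈ levIndex m Λ, ∀ p' ∈ levIndex m Λ, ∀ w : 𝔸,
          fnorm τ ((cZd L U₀ η τ hτp m a Λ s hd hη hτt hτs hU ha (hinj U₀ hU) (singleL m Λ p' w) : ℕ × Site d → 𝔸) p) ≤
            Real.exp (-(κ * (linfDist (loc p) (loc p') : ℝ))) / (c - ϱ) * fnorm τ w := by
  obtain ⟨c, hc, hco⟩ := B9Eq325QGGQCoerciveCompactZd.exists_coercive_levForm_qggq_plaqClosed τ hτp hτt hτs hd hL hη m ha Λ s hβ hinj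
  exact ⟨c, hc, fun U₀ hU hplaq κ ϱ hκ hϱ Amaj hA hblock hrow hcol p hp p' hp' w =>
    fnorm_cZd_single_le_exp_of_coercive L U₀ η τ hτp m a Λ s hd hη hτt hτs hU ha (hinj U₀ hU) loc hκ (hco U₀ hU hplaq) Amaj hA hblock hrow hcol hϱ hp hp' w⟩

end PlaqClosed

end Literature.MathematicalPhysics.QuantumFieldTheory.Balaban1983to89.B9Eq325QGGQDecayOfCoerciveZd

end
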